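import Literature.IUT.LogVolume.UnitLogWildDyadic
import Literature.IUT.LogVolume.LocalUnitLogEquivariance
import Literature.NumberTheory.GaloisRepresentations.NormUniformizer
import HarnessLib

/-!
# `stub_heegnerIndexLowerAtTwo` — stub-ideation k = 1 (gen 31): the TORSION CENSUS of `D_σ = (1 − σ)U¹(L)`
# as FRAME THEOREMS (technique: weaken / strengthen), kernel-checked, no `sorry`

Node attacked: STUB-PLAN v6.2 **R202** (census inputs `μ_{2^∞}(L_n) ⊂ {±1, ±i}` from `e(L_n/ℚ₂) = 2`,
`v(√u) = v₂(u)`, `v` a hom, `σ` an isometry) — here PROVED at the level of the normed frame of record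
(k3-g31 / k1-g30: `[NontriviallyNormedField L] [NormedAlgebra ℚ_[2] L] [IsUltrametricDist L] [ProperSpace L]`,
`σ : L ≃ₐ[ℚ_[2]] L`), with the WEAKEST hypotheses that make them true:

* §1 (STRONGEST form of census input (i)): `pow_four_ne_neg_one` — NO primitive 8th root of unity in ANY
  ultrametric normed `ℚ₂`-algebra field whose value group is `c^ℤ` with `c^e = ‖2‖`, `4 ∤ e`; the proof is the
  one-line identity `(ζ − 1)⁴ = −2ζ(2ζ² − 3ζ + 2)` (so `‖ζ − 1‖⁴ = ‖2‖`, i.e. `e = 4·v(ζ − 1)`).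
  `pow_four_eq_one_of_torsion`: every torsion principal unit then satisfies `ζ⁴ = 1`.
* §2 (the census, WEAKEST frame): for an involution `σ` whose fixed field is absolutely unramified IN NORM
  (`hFix : σ a = a, a ≠ 0 ⇒ ‖a‖ ∈ ‖2‖^ℤ`) — nothing else (`e(L/ℚ₂) ∣ 2` is DERIVED, `exists_norm_eq_zpow_of_fixed`) —
  `torsion_principalQuot_subset`: every torsion element of `D_σ := {x/σx : ‖x − 1‖ < 1}` is `±1`
  (the case `q² = −1` is killed by `p = 1 + q`, `p·σp = 2`, `p = q·σp`: `p·σx` is `σ`-fixed of norm `2^{−1/2}`).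
* §3 (the census BIT, key-free): `−1 ∈ D_σ ↔ ∃` principal `y` with `σy = −y`; with the frame's `s` (`σs = −s`):
  `‖s² − 1‖ < 1 ⇒ −1 ∈ D_σ` (keys `u ≡ 3 mod 4`: conductor 4) and `‖s‖ ∉ ‖2‖^ℤ ⇒` no anti-invariant UNIT at all
  (keys `2 ∥ u`: conductor 8); `‖s‖² = ‖u‖` (census input (ii)); and `i ∈ L ⇒ −1 ∈ D_σ` (so conductor 8 ⇒ `i ∉ L_n`
  at every layer — the B51 cross-check as a theorem, replacing the keyed bit `[i ∈ L_n]`).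
* §4 bridge to k1-g29's additive hypotheses: `hFix ⇒ (σ a = a ⇒ 2 ∣ ord_ϖ a)` (`two_dvd_ordFun_of_fixed`).

BSD is NOT proved by any of this; nothing here touches the route's `closes`, the skeleton or its stubs.
-/

noncomputable section

open Metric Set
open Literature.IUT.LogVolume
open Literature.NumberTheory.GaloisRepresentations.Ultrametric

set_option linter.dupNamespace false

namespace Summit.BirchSwinnertonDyer.BirchSwinnertonDyer.Cruxes.SplitBadTwoLowerHalfOfFacts.TorsionCensusFrameK1G31

/-! ## §0 Two real-number facts about `2⁻¹`-powers -/

theorem half_zpow_sq_ne_half (k : ℤ) : ((2 : ℝ)⁻¹ ^ k) ^ 2 ≠ 2⁻¹ := by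
  intro h
  rw [← zpow_natCast, ← zpow_mul] at h
  have h' := zpow_right_injective₀ (by norm_num : (0 : ℝ) < 2⁻¹) (by norm_num : (2 : ℝ)⁻¹ ≠ 1)
    (h.trans (zpow_one _).symm)
  push_cast at h'
  omega

section NoSigma

variable {L : Type*} [NontriviallyNormedField L] [NormedAlgebra ℚ_[2] L] [IsUltrametricDist L]

/-! ## §1 No primitive 8th root of unity when `4 ∤ e` (census input (i), strongest form) -/

theorem norm_three : ‖(3 : L)‖ = 1 := by
  have h2 : ‖(2 : L)‖ = 2⁻¹ := WildDyadic.norm_two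
  have h : (3 : L) = 1 + 2 := by norm_num
  rw [h, IsUltrametricDist.norm_add_eq_max_of_norm_ne_norm (by rw [norm_one, h2]; norm_num), norm_one, h2]
  exact max_eq_left (by norm_num)

omit [NormedAlgebra ℚ_[2] L] in
/-- A principal unit is a unit. -/
theorem norm_eq_one_of_norm_sub_one_lt {ζ : L} (h1 : ‖ζ - 1‖ < 1) : ‖ζ‖ = 1 := by
  have h : ζ = (ζ - 1) + 1 := by ring
  rw [h, IsUltrametricDist.norm_add_eq_max_of_norm_ne_norm (by rw [norm_one]; exact h1.ne), norm_one]
  exact max_eq_right h1.le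

omit [NormedAlgebra ℚ_[2] L] in
/-- Powers of principal units are principal units. -/
theorem norm_pow_sub_one_lt {ζ : L} (h1 : ‖ζ - 1‖ < 1) (i : ℕ) : ‖ζ ^ i - 1‖ < 1 := by
  induction i with
  | zero => simp
  | succ i ih =>
    have h : ζ ^ (i + 1) - 1 = ζ * (ζ ^ i - 1) + (ζ - 1) := by ring
    rw [h]
    refine (IsUltrametricDist.norm_add_le_max _ _).trans_lt (max_lt ?_ h1)
    rw [norm_mul, norm_eq_one_of_norm_sub_one_lt h1, one_mul]
    exact ih

/-- `‖m‖ = 1` for odd `m`. -/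
theorem norm_natCast_of_odd {m : ℕ} (hm : Odd m) : ‖(m : L)‖ = 1 := by
  obtain ⟨k, rfl⟩ := hm
  have h2 : ‖(2 : L)‖ = 2⁻¹ := WildDyadic.norm_two
  have hlt : ‖(2 * k : L)‖ < 1 := by
    rw [norm_mul, h2]
    calc (2 : ℝ)⁻¹ * ‖(k : L)‖ ≤ 2⁻¹ * 1 := by
          gcongr; exact IsUltrametricDist.norm_natCast_le_one L k
      _ < 1 := by norm_num
  push_cast
  rw [add_comm, IsUltrametricDist.norm_add_eq_max_of_norm_ne_norm (by rw [norm_one]; exact hlt.ne'),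
    norm_one]
  exact max_eq_left hlt.le

/-- **A torsion principal unit of odd order is trivial** (`U¹` is a pro-2 group). -/
theorem eq_one_of_pow_eq_one_of_odd {ζ : L} (h1 : ‖ζ - 1‖ < 1) {m : ℕ} (hm : Odd m) (h : ζ ^ m = 1) :
    ζ = 1 := by
  by_contra hne
  have hgeom : (ζ - 1) * (∑ i ∈ Finset.range m, ζ ^ i) = 0 := by
    rw [mul_comm, geom_sum_mul, h, sub_self]
  have hS : (∑ i ∈ Finset.range m, ζ ^ i) = 0 := by
    rcases mul_eq_zero.mp hgeom with h0 | h0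
    · exact absurd (sub_eq_zero.mp h0) hne
    · exact h0
  have hsum : ∀ n : ℕ, ‖∑ i ∈ Finset.range n, (ζ ^ i - 1)‖ < 1 := by
    intro n
    induction n with
    | zero => simp
    | succ n ih =>
      rw [Finset.sum_range_succ]
      exact (IsUltrametricDist.norm_add_le_max _ _).trans_lt (max_lt ih (norm_pow_sub_one_lt h1 n))
  have hdiff : (∑ i ∈ Finset.range m, ζ ^ i) - (m : L) = ∑ i ∈ Finset.range m, (ζ ^ i - 1) := by
    rw [Finset.sum_sub_distrib]
    simp
  have hlt : ‖(∑ i ∈ Finset.range m, ζ ^ i) - (m : L)‖ < 1 := by rw [hdiff]; exact hsum m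
  rw [hS, zero_sub, norm_neg, norm_natCast_of_odd hm] at hlt
  exact lt_irrefl _ hlt

/-- **STRONGEST FORM of census input (i).** In an ultrametric normed `ℚ₂`-algebra field whose norm group is
`c^ℤ` with `c^e = ‖2‖` and `4 ∤ e` there is no primitive 8th root of unity: `ζ⁴ ≠ −1`.
Proof: `(ζ − 1)⁴ = −2ζ(2ζ² − 3ζ + 2)` and `‖2ζ² − 3ζ + 2‖ = ‖3ζ‖ = 1`, so `‖ζ − 1‖⁴ = ‖2‖`, `4·k = e`. -/
theorem pow_four_ne_neg_one {c : ℝ} (hc : 0 < c) (hc1 : c < 1) {e : ℕ} (he : c ^ e = ‖(2 : L)‖)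
    (h4 : ¬ 4 ∣ e) (hval : ∀ x : L, x ≠ 0 → ∃ k : ℤ, ‖x‖ = c ^ k) (ζ : L) : ζ ^ 4 ≠ -1 := by
  intro h
  have h2 : ‖(2 : L)‖ = 2⁻¹ := WildDyadic.norm_two
  have hζ : ‖ζ‖ = 1 := by
    have h' : ‖ζ‖ ^ 4 = 1 := by rw [← norm_pow, h, norm_neg, norm_one]
    exact (pow_eq_one_iff_of_nonneg (norm_nonneg ζ) (by norm_num)).mp h'
  have hb : ‖-(3 * ζ)‖ = 1 := by rw [norm_neg, norm_mul, norm_three, hζ, one_mul]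
  have ha : ‖2 * ζ ^ 2 + 2‖ ≤ 2⁻¹ :=
    (IsUltrametricDist.norm_add_le_max _ _).trans
      (max_le (by rw [norm_mul, norm_pow, hζ, one_pow, mul_one, h2]) h2.le)
  have hq : ‖2 * ζ ^ 2 - 3 * ζ + 2‖ = 1 := by
    have h' : 2 * ζ ^ 2 - 3 * ζ + 2 = (2 * ζ ^ 2 + 2) + -(3 * ζ) := by ring
    rw [h', IsUltrametricDist.norm_add_eq_max_of_norm_ne_norm
      (by rw [hb]; exact (ha.trans_lt (by norm_num)).ne), hb]
    exact max_eq_right (ha.trans (by norm_num))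
  have hid : (ζ - 1) ^ 4 = -(2 * (ζ * (2 * ζ ^ 2 - 3 * ζ + 2))) := by linear_combination h
  have hn4 : ‖ζ - 1‖ ^ 4 = ‖(2 : L)‖ := by
    rw [← norm_pow, hid, norm_neg, norm_mul, norm_mul, hζ, hq, mul_one, mul_one]
  have hne : ζ - 1 ≠ 0 := by
    intro h0
    rw [h0, norm_zero, zero_pow (by norm_num), h2] at hn4
    norm_num at hn4
  obtain ⟨k, hk⟩ := hval (ζ - 1) hne
  have hn4' : c ^ (4 * k) = c ^ (e : ℤ) := by
    rw [zpow_natCast, he, ← hn4, hk, ← zpow_natCast, ← zpow_mul, mul_comm]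
    push_cast
    ring_nf
  have hk4 : 4 * k = (e : ℤ) := zpow_right_injective₀ hc hc1.ne hn4'
  have hdvd : ((4 : ℕ) : ℤ) ∣ (e : ℤ) := ⟨k, by rw [← hk4]; norm_num⟩
  exact h4 (Int.natCast_dvd_natCast.mp hdvd)

omit [NormedAlgebra ℚ_[2] L] [IsUltrametricDist L] in
/-- **`μ_{2^∞}(L) ⊆ μ₄`**: if `ζ⁴ ≠ −1` universally in `L` then `ζ^{2^j} = 1 ⇒ ζ⁴ = 1`. -/
theorem pow_four_eq_one_of_pow_two_pow (hL : ∀ ζ : L, ζ ^ 4 ≠ -1) :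
    ∀ (j : ℕ) (ζ : L), ζ ^ 2 ^ j = 1 → ζ ^ 4 = 1 := by
  intro j
  induction j with
  | zero =>
    intro ζ h
    rw [pow_zero, pow_one] at h
    rw [h, one_pow]
  | succ j ih =>
    intro ζ h
    have h2 : (ζ ^ 2) ^ 2 ^ j = 1 := by rw [← pow_mul, ← pow_succ']; exact h
    have h8 : (ζ ^ 2) ^ 4 = 1 := ih (ζ ^ 2) h2
    have hsq : ζ ^ 4 * ζ ^ 4 = 1 := by rw [← pow_mul] at h8; rw [← pow_add]; exact h8
    rcases mul_self_eq_one_iff.mp hsq with h' | h'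
    · exact h'
    · exact absurd h' (hL ζ)

/-- **Every torsion principal unit satisfies `ζ⁴ = 1`** (odd part dies in `U¹`, 2-part capped by §1). -/
theorem pow_four_eq_one_of_torsion (hL : ∀ ζ : L, ζ ^ 4 ≠ -1) {ζ : L} (h1 : ‖ζ - 1‖ < 1) {m : ℕ}
    (hm : m ≠ 0) (h : ζ ^ m = 1) : ζ ^ 4 = 1 := by
  obtain ⟨j, m', hnd, rfl⟩ := Nat.exists_eq_pow_mul_and_not_dvd hm 2 (by norm_num)
  have hodd : Odd m' := Nat.not_even_iff_odd.mp fun he => hnd (even_iff_two_dvd.mp he)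
  rw [mul_comm, pow_mul] at h
  have hη : ζ ^ 2 ^ j = 1 := by
    have h' : (ζ ^ 2 ^ j) ^ m' = 1 := by rw [← pow_mul, mul_comm, pow_mul]; exact h
    exact eq_one_of_pow_eq_one_of_odd (norm_pow_sub_one_lt h1 _) hodd h'
  exact pow_four_eq_one_of_pow_two_pow hL j ζ hη

omit [IsUltrametricDist L] in
/-- Census input (ii) **`v(√u) = v₂(u)`** in norm form: `s² = u ⇒ ‖s‖² = ‖u‖`. -/
theorem norm_sq_of_sq_eq {s : L} {u : ℚ_[2]} (h : s ^ 2 = algebraMap ℚ_[2] L u) : ‖s‖ ^ 2 = ‖u‖ := by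
  rw [← norm_pow, h, norm_algebraMap']

omit [IsUltrametricDist L] in
theorem norm_sq_sub_one_of_sq_eq {s : L} {u : ℚ_[2]} (h : s ^ 2 = algebraMap ℚ_[2] L u) :
    ‖s ^ 2 - 1‖ = ‖u - 1‖ := by
  rw [h, ← map_one (algebraMap ℚ_[2] L), ← map_sub, norm_algebraMap']

omit [IsUltrametricDist L] in
/-- `‖s‖² = 1/2 ⇒ ‖s‖ ∉ ‖2‖^ℤ` (the conductor-8 keys `u ∈ {±2, ±6}`: `‖u‖₂ = 1/2`). -/
theorem norm_ne_zpow_of_norm_sq {s : L} (hs : ‖s‖ ^ 2 = 2⁻¹) (k : ℤ) : ‖s‖ ≠ ‖(2 : L)‖ ^ k := by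
  intro hk
  rw [WildDyadic.norm_two] at hk
  exact half_zpow_sq_ne_half k (hk ▸ hs)

end NoSigma

/-! ## §2 The census: torsion of `D_σ = (1 − σ)U¹(L)` is `⊆ {±1}` -/

section Sigma

variable {L : Type*} [NontriviallyNormedField L] [NormedAlgebra ℚ_[2] L] [IsUltrametricDist L]
  [ProperSpace L]

omit [NormedAlgebra ℚ_[2] L] [ProperSpace L] in
theorem norm_sub_le_max' (x y : L) : ‖x - y‖ ≤ max ‖x‖ ‖y‖ := by
  rw [sub_eq_add_neg, ← norm_neg y]
  exact IsUltrametricDist.norm_add_le_max x (-y)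

variable (σ : L ≃ₐ[ℚ_[2]] L)

/-- `σ` is an isometry (tree `norm_map_algEquiv`; verbatim k1-g30). -/
theorem norm_map_sigma (x : L) : ‖σ x‖ = ‖x‖ := by
  haveI : FiniteDimensional ℚ_[2] L := FiniteDimensional.of_locallyCompactSpace ℚ_[2]
  haveI : Algebra.IsAlgebraic ℚ_[2] L := Algebra.IsAlgebraic.of_finite ℚ_[2] L
  exact norm_map_algEquiv 2 σ x

/-- **`D_σ := (1 − σ)U¹(L)`** written multiplicatively: the quotients `x/σx` of principal units
(`≅ U¹(L)/U¹(L)^σ = Q(u)` by `x ↦ x/σx`, kernel the `σ`-fixed principal units). -/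
def principalQuot : Set L := {q | ∃ x : L, ‖x - 1‖ < 1 ∧ q = x * (σ x)⁻¹}

omit [IsUltrametricDist L] [ProperSpace L] in
/-- `1 ∈ D_σ`. -/
theorem one_mem_principalQuot : (1 : L) ∈ principalQuot σ :=
  ⟨1, by simp, by rw [map_one, inv_one, mul_one]⟩

/-- **`e(L/ℚ₂) ∣ 2` is DERIVED from `hFix`:** `‖x‖² = ‖x·σx‖ ∈ ‖2‖^ℤ`, so `‖x‖ ∈ (2^{−1/2})^ℤ`. -/
theorem exists_norm_eq_zpow_of_fixed (hσ2 : ∀ x : L, σ (σ x) = x)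
    (hFix : ∀ a : L, a ≠ 0 → σ a = a → ∃ k : ℤ, ‖a‖ = ‖(2 : L)‖ ^ k) (x : L) (hx : x ≠ 0) :
    ∃ k : ℤ, ‖x‖ = Real.sqrt 2⁻¹ ^ k := by
  have hσx0 : σ x ≠ 0 := fun h0 => by
    have h := norm_map_sigma σ x
    rw [h0, norm_zero] at h
    exact hx (norm_eq_zero.mp h.symm)
  obtain ⟨k, hk⟩ := hFix (x * σ x) (mul_ne_zero hx hσx0) (by rw [map_mul, hσ2, mul_comm])
  refine ⟨k, ?_⟩
  rw [norm_mul, norm_map_sigma, WildDyadic.norm_two] at hk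
  have hk2 : ‖x‖ ^ 2 = (Real.sqrt 2⁻¹ ^ k) ^ 2 := by
    calc ‖x‖ ^ 2 = ‖x‖ * ‖x‖ := sq _
      _ = 2⁻¹ ^ k := hk
      _ = (Real.sqrt 2⁻¹ ^ 2) ^ k := by rw [Real.sq_sqrt (by norm_num : (0 : ℝ) ≤ 2⁻¹)]
      _ = (Real.sqrt 2⁻¹ ^ k) ^ 2 := by
          rw [← zpow_natCast, ← zpow_natCast, ← zpow_mul, ← zpow_mul, mul_comm]
  exact (pow_left_inj₀ (norm_nonneg x) (zpow_nonneg (Real.sqrt_nonneg _) k) two_ne_zero).mp hk2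

/-- In the `hFix` frame there is no primitive 8th root of unity (`e = 2`, `c = 2^{−1/2}` in §1). -/
theorem pow_four_ne_neg_one_of_fixed (hσ2 : ∀ x : L, σ (σ x) = x)
    (hFix : ∀ a : L, a ≠ 0 → σ a = a → ∃ k : ℤ, ‖a‖ = ‖(2 : L)‖ ^ k) (ζ : L) : ζ ^ 4 ≠ -1 :=
  pow_four_ne_neg_one (Real.sqrt_pos.mpr (by norm_num))
    ((Real.sqrt_lt' one_pos).mpr (by norm_num))
    (by rw [Real.sq_sqrt (by norm_num : (0 : ℝ) ≤ 2⁻¹), WildDyadic.norm_two]) (by decide)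
    (exists_norm_eq_zpow_of_fixed σ hσ2 hFix) ζ

/-- **Core step (the `±i ∉ D_n` of k1-g29 §T, key-free and layer-free):** an element `q` with `σq = −q`,
`q² = −1` is never of the form `x/σx` with `x` a unit — `p = 1 + q` has `p·σp = 2`, `p = q·σp`, so `p·σx`
is `σ`-fixed of norm `2^{−1/2} ∉ ‖2‖^ℤ`. -/
theorem false_of_sq_eq_neg_one (hσ2 : ∀ x : L, σ (σ x) = x)
    (hFix : ∀ a : L, a ≠ 0 → σ a = a → ∃ k : ℤ, ‖a‖ = ‖(2 : L)‖ ^ k)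
    {q x : L} (hσq : σ q = -q) (hq2 : q ^ 2 = -1) (hx : ‖x‖ = 1) (hqx : q * σ x = x) : False := by
  have h2 : ‖(2 : L)‖ = 2⁻¹ := WildDyadic.norm_two
  have hσp : σ (1 + q) = 1 - q := by rw [map_add, map_one, hσq, sub_eq_add_neg]
  have hpσp : (1 + q) * σ (1 + q) = 2 := by rw [hσp]; linear_combination (-1 : L) * hq2
  have hpq : q * σ (1 + q) = 1 + q := by rw [hσp]; linear_combination (-1 : L) * hq2
  have hnp : ‖1 + q‖ ^ 2 = 2⁻¹ := by rw [sq, ← h2, ← hpσp, norm_mul, norm_map_sigma]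
  have hσa : σ ((1 + q) * σ x) = (1 + q) * σ x := by
    rw [map_mul, hσ2]
    calc σ (1 + q) * x = σ (1 + q) * (q * σ x) := by rw [hqx]
      _ = (q * σ (1 + q)) * σ x := by ring
      _ = (1 + q) * σ x := by rw [hpq]
  have hna : ‖(1 + q) * σ x‖ = ‖1 + q‖ := by rw [norm_mul, norm_map_sigma, hx, mul_one]
  have ha0 : (1 + q) * σ x ≠ 0 := by
    intro h0
    rw [h0, norm_zero] at hna
    rw [← hna, zero_pow two_ne_zero] at hnp
    norm_num at hnp
  obtain ⟨k, hk⟩ := hFix _ ha0 hσa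
  rw [hna, h2] at hk
  exact half_zpow_sq_ne_half k (hk ▸ hnp)

/-- **THE CENSUS (frame theorem).** For an involution `σ` whose fixed field is absolutely unramified in norm,
every torsion element of `D_σ = (1 − σ)U¹(L)` is `±1`. -/
theorem torsion_principalQuot_subset (hσ2 : ∀ x : L, σ (σ x) = x)
    (hFix : ∀ a : L, a ≠ 0 → σ a = a → ∃ k : ℤ, ‖a‖ = ‖(2 : L)‖ ^ k)
    {q : L} (hq : q ∈ principalQuot σ) {m : ℕ} (hm : m ≠ 0) (hqm : q ^ m = 1) : q = 1 ∨ q = -1 := by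
  obtain ⟨x, hx1, rfl⟩ := hq
  have hx : ‖x‖ = 1 := norm_eq_one_of_norm_sub_one_lt hx1
  have hσx : ‖σ x‖ = 1 := by rw [norm_map_sigma, hx]
  have hσx0 : σ x ≠ 0 := fun h => by rw [h, norm_zero] at hσx; exact zero_ne_one hσx
  have hq1 : ‖x * (σ x)⁻¹ - 1‖ < 1 := by
    have h' : x * (σ x)⁻¹ - 1 = ((x - 1) - (σ x - 1)) * (σ x)⁻¹ := by field_simp; ring
    rw [h', norm_mul, norm_inv, hσx, inv_one, mul_one]
    refine (norm_sub_le_max' _ _).trans_lt (max_lt hx1 ?_)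
    rw [← map_one σ, ← map_sub, norm_map_sigma]
    exact hx1
  have h4 : (x * (σ x)⁻¹) ^ 4 = 1 :=
    pow_four_eq_one_of_torsion (pow_four_ne_neg_one_of_fixed σ hσ2 hFix) hq1 hm hqm
  have hsq : (x * (σ x)⁻¹) ^ 2 * (x * (σ x)⁻¹) ^ 2 = 1 := by rw [← pow_add]; exact h4
  rcases mul_self_eq_one_iff.mp hsq with h | h
  · exact mul_self_eq_one_iff.mp (by rw [← pow_two]; exact h)
  · exfalso
    set q := x * (σ x)⁻¹ with hqdef
    have hσq' : σ q = q⁻¹ := by rw [hqdef, map_mul, map_inv₀, hσ2, mul_inv_rev, inv_inv]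
    have hqinv : q⁻¹ = -q := inv_eq_of_mul_eq_one_right (by linear_combination (-1 : L) * h)
    have hqx : q * σ x = x := by rw [hqdef, inv_mul_cancel_right₀ hσx0]
    exact false_of_sq_eq_neg_one σ hσ2 hFix (hσq'.trans hqinv) h hx hqx

/-- The census as a set statement: `tors(D_σ) ⊆ {1, −1}`. -/
theorem torsionSet_principalQuot_subset (hσ2 : ∀ x : L, σ (σ x) = x)
    (hFix : ∀ a : L, a ≠ 0 → σ a = a → ∃ k : ℤ, ‖a‖ = ‖(2 : L)‖ ^ k) :
    {q ∈ principalQuot σ | ∃ m : ℕ, m ≠ 0 ∧ q ^ m = 1} ⊆ {1, -1} := by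
  rintro q ⟨hq, m, hm, hqm⟩
  rcases torsion_principalQuot_subset σ hσ2 hFix hq hm hqm with h | h
  · exact Or.inl h
  · exact Or.inr h

/-! ## §3 The census BIT `−1 ∈ D_σ`, key-free -/

/-- `−1 ∈ D_σ ↔` some principal unit is `σ`-anti-invariant. -/
theorem neg_one_mem_principalQuot_iff :
    (-1 : L) ∈ principalQuot σ ↔ ∃ y : L, ‖y - 1‖ < 1 ∧ σ y = -y := by
  constructor
  · rintro ⟨y, hy1, h⟩
    have hy : ‖σ y‖ = 1 := by rw [norm_map_sigma, norm_eq_one_of_norm_sub_one_lt hy1]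
    have hy0 : σ y ≠ 0 := fun h0 => by rw [h0, norm_zero] at hy; exact zero_ne_one hy
    rw [eq_mul_inv_iff_mul_eq₀ hy0] at h
    exact ⟨y, hy1, by linear_combination -h⟩
  · rintro ⟨y, hy1, h⟩
    have hy : ‖y‖ = 1 := norm_eq_one_of_norm_sub_one_lt hy1
    have hy0 : y ≠ 0 := fun h0 => by rw [h0, norm_zero] at hy; exact zero_ne_one hy
    exact ⟨y, hy1, by rw [h, inv_neg, mul_neg, mul_inv_cancel₀ hy0]⟩

/-- An anti-invariant `s` with `‖s² − 1‖ < 1` is a principal unit (`‖s − 1‖ = ‖s + 1‖`). -/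
theorem norm_sub_one_lt_of_anti {s : L} (hσs : σ s = -s) (hs : ‖s ^ 2 - 1‖ < 1) : ‖s - 1‖ < 1 := by
  have h : ‖s + 1‖ = ‖s - 1‖ := by
    rw [← norm_map_sigma σ (s - 1), map_sub, map_one, hσs, ← norm_neg (s + 1)]
    congr 1
    ring
  have h2 : ‖s - 1‖ ^ 2 = ‖s ^ 2 - 1‖ := by
    rw [show s ^ 2 - 1 = (s - 1) * (s + 1) by ring, norm_mul, h, sq]
  exact (pow_lt_one_iff_of_nonneg (norm_nonneg _) two_ne_zero).mp (h2 ▸ hs)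

/-- **Conductor-4 half of the bit:** `σs = −s`, `‖s² − 1‖ < 1 ⇒ −1 ∈ D_σ` (keys `u ≡ 3 (mod 4)`:
`‖u − 1‖₂ = 1/2`, via `norm_sq_sub_one_of_sq_eq`). -/
theorem neg_one_mem_principalQuot_of_anti {s : L} (hσs : σ s = -s) (hs : ‖s ^ 2 - 1‖ < 1) :
    (-1 : L) ∈ principalQuot σ :=
  (neg_one_mem_principalQuot_iff σ).mpr ⟨s, norm_sub_one_lt_of_anti σ hσs hs, hσs⟩

omit [IsUltrametricDist L] [ProperSpace L] in
/-- **Conductor-8 half of the bit:** if the frame's anti-invariant `s ≠ 0` has `‖s‖ ∉ ‖2‖^ℤ` (keys `2 ∥ u`: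
`‖s‖² = ‖u‖₂ = 1/2`, via `norm_sq_of_sq_eq` + `norm_ne_zpow_of_norm_sq`) then NO unit is anti-invariant. -/
theorem not_exists_anti_unit (hFix : ∀ a : L, a ≠ 0 → σ a = a → ∃ k : ℤ, ‖a‖ = ‖(2 : L)‖ ^ k)
    {s : L} (hs0 : s ≠ 0) (hσs : σ s = -s) (hns : ∀ k : ℤ, ‖s‖ ≠ ‖(2 : L)‖ ^ k) :
    ¬ ∃ y : L, ‖y‖ = 1 ∧ σ y = -y := by
  rintro ⟨y, hy, hσy⟩
  have hy0 : y ≠ 0 := fun h0 => by rw [h0, norm_zero] at hy; exact zero_ne_one hy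
  obtain ⟨k, hk⟩ := hFix (y * s) (mul_ne_zero hy0 hs0) (by rw [map_mul, hσy, hσs, neg_mul_neg])
  rw [norm_mul, hy, one_mul] at hk
  exact hns k hk

/-- … hence `−1 ∉ D_σ`: in the conductor-8 frames `D_σ` is TORSION-FREE (with `torsion_principalQuot_subset`). -/
theorem neg_one_not_mem_principalQuot (hFix : ∀ a : L, a ≠ 0 → σ a = a → ∃ k : ℤ, ‖a‖ = ‖(2 : L)‖ ^ k)
    {s : L} (hs0 : s ≠ 0) (hσs : σ s = -s) (hns : ∀ k : ℤ, ‖s‖ ≠ ‖(2 : L)‖ ^ k) :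
    (-1 : L) ∉ principalQuot σ := fun h => by
  obtain ⟨y, hy1, hσy⟩ := (neg_one_mem_principalQuot_iff σ).mp h
  exact not_exists_anti_unit σ hFix hs0 hσs hns ⟨y, norm_eq_one_of_norm_sub_one_lt hy1, hσy⟩

/-- **Torsion-free census (conductor 8):** every torsion element of `D_σ` is `1`. -/
theorem torsion_principalQuot_eq_one (hσ2 : ∀ x : L, σ (σ x) = x)
    (hFix : ∀ a : L, a ≠ 0 → σ a = a → ∃ k : ℤ, ‖a‖ = ‖(2 : L)‖ ^ k)
    {s : L} (hs0 : s ≠ 0) (hσs : σ s = -s) (hns : ∀ k : ℤ, ‖s‖ ≠ ‖(2 : L)‖ ^ k)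
    {q : L} (hq : q ∈ principalQuot σ) {m : ℕ} (hm : m ≠ 0) (hqm : q ^ m = 1) : q = 1 := by
  rcases torsion_principalQuot_subset σ hσ2 hFix hq hm hqm with h | h
  · exact h
  · exact absurd (h ▸ hq) (neg_one_not_mem_principalQuot σ hFix hs0 hσs hns)

/-- **Two-element census (conductor 4):** the torsion of `D_σ` is exactly `{1, −1}`. -/
theorem torsionSet_principalQuot_eq_pair (hσ2 : ∀ x : L, σ (σ x) = x)
    (hFix : ∀ a : L, a ≠ 0 → σ a = a → ∃ k : ℤ, ‖a‖ = ‖(2 : L)‖ ^ k)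
    {s : L} (hσs : σ s = -s) (hs : ‖s ^ 2 - 1‖ < 1) :
    {q ∈ principalQuot σ | ∃ m : ℕ, m ≠ 0 ∧ q ^ m = 1} = {1, -1} := by
  refine Set.Subset.antisymm (torsionSet_principalQuot_subset σ hσ2 hFix) ?_
  rintro q (rfl | rfl)
  · exact ⟨one_mem_principalQuot σ, 1, one_ne_zero, one_pow 1⟩
  · exact ⟨neg_one_mem_principalQuot_of_anti σ hσs hs, 2, two_ne_zero, by norm_num⟩

omit [IsUltrametricDist L] [ProperSpace L] in
/-- **`i ∈ L` forces `σ i = −i`** under `hFix` (`1 + i` fixed would have norm `2^{−1/2}`). -/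
theorem sigma_eq_neg_of_sq_eq_neg_one
    (hFix : ∀ a : L, a ≠ 0 → σ a = a → ∃ k : ℤ, ‖a‖ = ‖(2 : L)‖ ^ k)
    {i : L} (hi : i ^ 2 = -1) : σ i = -i := by
  have hσi2 : (σ i) ^ 2 = -1 := by rw [← map_pow, hi, map_neg, map_one]
  have hprod : (σ i - i) * (σ i + i) = 0 := by linear_combination hσi2 - hi
  rcases mul_eq_zero.mp hprod with h | h
  · exfalso
    have hfix : σ i = i := sub_eq_zero.mp h
    have hi1 : ‖i‖ = 1 := by
      have h' : ‖i‖ ^ 2 = 1 := by rw [← norm_pow, hi, norm_neg, norm_one]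
      exact (pow_eq_one_iff_of_nonneg (norm_nonneg i) two_ne_zero).mp h'
    have hn : ‖1 + i‖ ^ 2 = 2⁻¹ := by
      rw [← norm_pow, show (1 + i) ^ 2 = 2 * i by linear_combination hi, norm_mul, WildDyadic.norm_two,
        hi1, mul_one]
    have h0 : 1 + i ≠ 0 := by
      intro h0
      rw [h0, norm_zero, zero_pow two_ne_zero] at hn
      norm_num at hn
    obtain ⟨k, hk⟩ := hFix (1 + i) h0 (by rw [map_add, map_one, hfix])
    rw [WildDyadic.norm_two] at hk
    exact half_zpow_sq_ne_half k (hk ▸ hn)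
  · exact eq_neg_of_add_eq_zero_left h

/-- **`i ∈ L ⇒ −1 ∈ D_σ`**; contrapositively, in the torsion-free (conductor-8) frames `i ∉ L_n` at every
layer — the B51 cross-check as a theorem (replaces the keyed bit `[i ∈ L_n]` of k3-g30). -/
theorem neg_one_mem_principalQuot_of_sq_eq_neg_one
    (hFix : ∀ a : L, a ≠ 0 → σ a = a → ∃ k : ℤ, ‖a‖ = ‖(2 : L)‖ ^ k)
    {i : L} (hi : i ^ 2 = -1) : (-1 : L) ∈ principalQuot σ := by
  refine neg_one_mem_principalQuot_of_anti σ (sigma_eq_neg_of_sq_eq_neg_one σ hFix hi) ?_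
  rw [hi, show (-1 : L) - 1 = -2 by norm_num, norm_neg, WildDyadic.norm_two]
  norm_num

theorem sq_ne_neg_one_of_neg_one_not_mem (hFix : ∀ a : L, a ≠ 0 → σ a = a → ∃ k : ℤ, ‖a‖ = ‖(2 : L)‖ ^ k)
    (h : (-1 : L) ∉ principalQuot σ) (i : L) : i ^ 2 ≠ -1 := fun hi =>
  h (neg_one_mem_principalQuot_of_sq_eq_neg_one σ hFix hi)

/-! ## §4 Bridge to k1-g29's additive census hypotheses (`hF : σ a = a → 2 ∣ v a`) -/

omit [IsUltrametricDist L] [ProperSpace L] in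
/-- `hFix ⇒` every `σ`-fixed unit has EVEN `ϖ`-adic order, for any norm uniformizer `ϖ` with `‖ϖ‖² = ‖2‖`
(k1-g29's hypothesis `hF`, with `v = IsUniformizer.ordFun`, additive by tree `ordFun_mul`). -/
theorem two_dvd_ordFun_of_fixed (hFix : ∀ a : L, a ≠ 0 → σ a = a → ∃ k : ℤ, ‖a‖ = ‖(2 : L)‖ ^ k)
    {ϖ : Lˣ} (hϖ : IsUniformizer ϖ) (hϖ2 : ‖(ϖ : L)‖ ^ 2 = ‖(2 : L)‖) (a : Lˣ) (ha : σ (a : L) = a) :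
    (2 : ℤ) ∣ hϖ.ordFun a := by
  obtain ⟨k, hk⟩ := hFix a a.ne_zero ha
  refine ⟨k, ?_⟩
  rw [hϖ.ordFun_eq_iff, hk, ← hϖ2, ← zpow_natCast, ← zpow_mul]
  push_cast
  ring_nf

omit [IsUltrametricDist L] [ProperSpace L] in
/-- Conversely the value group is all of `(2^{−1/2})^ℤ`-shaped: `ord_ϖ 2 = 2` when `‖ϖ‖² = ‖2‖`
(k1-g29's `hvf₀ : v f₀ = 2` with `f₀ = 2`). -/
theorem ordFun_two {ϖ : Lˣ} (hϖ : IsUniformizer ϖ) (hϖ2 : ‖(ϖ : L)‖ ^ 2 = ‖(2 : L)‖) :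
    hϖ.ordFun (Units.mk0 (2 : L) (by
      intro h; have h2 : ‖(2 : L)‖ = 2⁻¹ := WildDyadic.norm_two; rw [h, norm_zero] at h2; norm_num at h2)) = 2 := by
  rw [hϖ.ordFun_eq_iff, Units.val_mk0, ← hϖ2, zpow_ofNat]

end Sigma

end Summit.BirchSwinnertonDyer.BirchSwinnertonDyer.Cruxes.SplitBadTwoLowerHalfOfFacts.TorsionCensusFrameK1G31

end
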